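import Mathlib
import Summits.PneNP.PneNP.Theorems.ClusUniversalCertificatePairModelDefs
import Summits.PneNP.PneNP.Theses.ClusUniversalCertificate

/-!
# Route ClusUniversalCertificate — crux `PairModelReduction` (stmt-PneNP-19684), line `birth`: STUB `stub_liftCap_of_cert`

The registered stub `stub_liftCap_of_cert : UniversalCertAll → LiftCapSharpAll` of skeleton `birth` (sha16 04524c82) of crux
`Summit.PneNP.PneNP.Theses.ClusUniversalCertificate.PairModelReduction` (stmt-PneNP-19684, rung F-N1, cell pnp-ideate p1),
BY NAME: the route's crux `UniversalCertAll` (stmt-PneNP-19683, its certificate codimension inlined as an `sInf`) is,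
pointwise in `n, m`, the tree's `ClusCube.Block.UniversalCert n m` (same `sInf`, named `ClusCube.Block.codimIn`), and the
route-independent lemma `ClusPairModel.liftCapSharpAll_of_universalCert` turns that into `LiftCapSharpAll`.
Honest scope: this is the interface stub (size M) of the line; its load-bearing stub `stub_polyloss_of_liftCap`
(LiftCap ⇒ PolyLoss) and the crux `UniversalCertAll` itself are OPEN; nothing here bears on P vs NP.
This file imports the route file because the stub's hypothesis is the route decl.
-/

set_option linter.dupNamespace false -- `Summit.PneNP.PneNP.…`: summit = sub-problem name (D-0017 single-conjunct layout)

namespace Summit.PneNP.PneNP.Theorems.ClusPairModel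

open Summit.PneNP.PneNP.Theses.ClusUniversalCertificate

/-- **STUB `stub_liftCap_of_cert` of line `birth` (stmt-PneNP-19684)**: the universal certificate (route decl
`UniversalCertAll`) implies SHARP LiftCap for all parameters.  [folklore; port of the cell theorem
`liftCapSharp_of_universal`, via `ClusPairModel.liftCapSharpAll_of_universalCert`] -/
theorem stub_liftCap_of_cert : UniversalCertAll → LiftCapSharpAll := by
  intro h
  apply liftCapSharpAll_of_universalCert
  intro n m Y
  exact h n m Y

end Summit.PneNP.PneNP.Theorems.ClusPairModel
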